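import Mathlib
import Literature.NumberTheory.LFunctions.Zhang2022.Section16Lemma162RLocal
import HarnessLib

/-!
# Zhang (2022) §16 Lemma 16.2 at the repaired normaliser (GAP row G-d57-1), part 3: the Euler factor
# `Φ_q(s) = N_q(s)·C_q(s)` of `E₂ⱼ` on `σ > 9/10` — size, holomorphy, and `Φ_q = 1 + O(q^{−1−σ} + q^{−2σ})`

Topic `Literature/NumberTheory/LFunctions/Zhang2022` (Landau–Siegel audit tree; verdict-neutral).
Y. Zhang, *Discrete mean estimates and the Landau–Siegel zero*, arXiv:2211.02515v1 (2022)
[Zhang2022LandauSiegel] — **an unrefereed manuscript under adjudication; nothing here asserts or denies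
its Theorems 1–2.** ZHANG-L WP16 block D, sub-leaf `Typed.Section16B.Lemma162R` (Lemma 16.2, §16 p. 94:
"`𝔲₂ⱼ(s)` … is analytic and bounded for `σ > 9/10`"; App. A pp. 105–106). Theorems only; no definitions.

With `x = q^{−s}`, `w = q^{β_j}` (unimodular), `v = χ(q) ∈ {0, ±1}` the Euler factor of
`E₂ⱼ = (ζ²ζ(·−β_j)L L(·−β_j)²)⁻¹Σϖ₂ⱼ(ν∗χ)n^{−s}` at an odd prime `q` is `Φ_q = N_q·C_q`,
`N_q = (1−x)²(1−wx)(1−vx)(1−vwx)²`, `C_q = Σ_e c_e x^e`, `c_e = ϖ₂ⱼ^loc(q^e)(ν∗χ)(q^e)`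
(part 2, `Lemma162R.hasProd_frakU2SeriesR`). This file proves, for a power series with
`|c_e| ≤ M(e+1)³` and `|x| ≤ 3/5`:
* `‖Σ c_e x^e‖ ≤ 235M`, `‖Σ c_e x^e − c₀ − c₁x‖ ≤ 1100M‖x‖²` (via `(e+1)³ ≤ 6·C(e+3,3)`,
  `(e+3)³ ≤ 27·C(e+3,3)` and `Σ C(e+3,3)rᵉ = (1−r)⁻⁴`), holomorphy of `s ↦ Σ c_e q^{−es}` on `σ > 9/10`;
* `‖N_q‖ ≤ 17`, `‖N_q − 1 + (2 + w + v + 2vw)x‖ ≤ 35‖x‖²`;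
* **the cancellation of the linear coefficients** for `v = ±1`, `q ≥ 700`:
  `c₁ − (2+w+v+2vw) = (λ₂(q)ρ₁₀ − 1)(w + 2vw) + (ρ₀₁ − 1)(v + 2)` is `O(q⁻¹)` in norm (`≤ 8500/q`), whence
  `‖Φ_q(s) − 1‖ ≤ 8500‖x‖/q + 5·10⁷‖x‖²` (App. A p. 105: "`= 1 + O(q^{−19/10})`" at the level of `E₂ⱼ`);
* for `v = 0`: `Φ_q(s) = (1 − x)²` exactly.

## References

* Y. Zhang, arXiv:2211.02515v1 (2022), §16 Lemma 16.2 p. 94; App. A pp. 105–106.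
  [cite: Zhang2022LandauSiegel, §16 Lemma 16.2 p.94]
-/

noncomputable section

open Complex Real Finset Filter Topology

namespace Literature.NumberTheory.LFunctions.Zhang2022.Lemma162R

open Literature.NumberTheory.LFunctions.Zhang2022
open Literature.NumberTheory.LFunctions.Zhang2022.Skeleton
open Literature.NumberTheory.LFunctions.Zhang2022.Typed.Section16A
open Literature.NumberTheory.LFunctions.Zhang2022.Typed.Section16B
open Literature.NumberTheory.LFunctions.Zhang2022.AppendixA

/-! ## §1. Power series with cubic-polynomial coefficient growth -/

section Series

/-- `(e+1)(e+2)(e+3) = 6·C(e+3,3)`. [folklore] -/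
private theorem choose_three_mul_six (e : ℕ) : 6 * (e + 3).choose 3 = (e + 1) * (e + 2) * (e + 3) := by
  have h := Nat.choose_mul_factorial_mul_factorial (show 3 ≤ e + 3 by omega)
  rw [show e + 3 - 3 = e from by omega] at h
  have h3 : (3 : ℕ).factorial = 6 := by decide
  have hf : (e + 3).factorial = (e + 1) * (e + 2) * (e + 3) * e.factorial := by
    rw [show e + 3 = (e + 2) + 1 from rfl, Nat.factorial_succ, show e + 2 = (e + 1) + 1 from rfl,
      Nat.factorial_succ, Nat.factorial_succ]; ring
  rw [h3, hf] at h
  have he : 0 < e.factorial := Nat.factorial_pos e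
  apply Nat.eq_of_mul_eq_mul_right he
  calc 6 * (e + 3).choose 3 * e.factorial = (e + 3).choose 3 * 6 * e.factorial := by ring
    _ = (e + 1) * (e + 2) * (e + 3) * e.factorial := h

/-- `(e+1)³ ≤ 6·C(e+3,3)` and `(e+3)³ ≤ 27·C(e+3,3)` (as reals). [folklore] -/
private theorem cube_le_choose (e : ℕ) :
    ((e : ℝ) + 1) ^ 3 ≤ 6 * ((e + 3).choose 3 : ℝ) ∧ ((e : ℝ) + 3) ^ 3 ≤ 27 * ((e + 3).choose 3 : ℝ) := by
  have h : (6 : ℝ) * ((e + 3).choose 3 : ℝ) = ((e : ℝ) + 1) * ((e : ℝ) + 2) * ((e : ℝ) + 3) := by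
    exact_mod_cast choose_three_mul_six e
  have he : (0 : ℝ) ≤ e := Nat.cast_nonneg e
  constructor
  · rw [h]; nlinarith [mul_nonneg he he, mul_nonneg (mul_nonneg he he) he]
  · rw [show (27 : ℝ) * ((e + 3).choose 3 : ℝ) = 9 / 2 * (6 * ((e + 3).choose 3 : ℝ)) by ring, h]
    nlinarith [mul_nonneg he he, mul_nonneg (mul_nonneg he he) he]

/-- For `0 ≤ r < 1`: `Σ_e C(e+3,3) rᵉ = (1−r)⁻⁴` is summable with that value. [folklore] -/
private theorem hasSum_choose_three {r : ℝ} (hr0 : 0 ≤ r) (hr : r < 1) :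
    HasSum (fun e : ℕ => ((e + 3).choose 3 : ℝ) * r ^ e) (1 / (1 - r) ^ 4) := by
  have h := hasSum_choose_mul_geometric_of_norm_lt_one 3 (r := r) (by rw [Real.norm_eq_abs, abs_of_nonneg hr0]; exact hr)
  simpa using h

/-- **Summability**: `|c_e| ≤ M(e+1)³`, `‖y‖ < 1` ⇒ `Σ c_e yᵉ` converges absolutely. [folklore] -/
private theorem summable_norm_coeff_mul_pow {c : ℕ → ℂ} {M : ℝ} (hc : ∀ e, ‖c e‖ ≤ M * ((e : ℝ) + 1) ^ 3)
    {y : ℂ} (hy : ‖y‖ < 1) : Summable fun e : ℕ => ‖c e * y ^ e‖ := by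
  have hM : 0 ≤ M := by have := hc 0; simp at this; linarith [norm_nonneg (c 0)]
  have hs := ((hasSum_choose_three (norm_nonneg y) hy).summable.mul_left (6 * M))
  refine Summable.of_nonneg_of_le (fun _ => norm_nonneg _) (fun e => ?_) hs
  rw [norm_mul, norm_pow]
  have h1 := (cube_le_choose e).1
  calc ‖c e‖ * ‖y‖ ^ e ≤ (M * ((e : ℝ) + 1) ^ 3) * ‖y‖ ^ e := by gcongr; exact hc e
    _ ≤ (M * (6 * ((e + 3).choose 3 : ℝ))) * ‖y‖ ^ e := by gcongr
    _ = 6 * M * (((e + 3).choose 3 : ℝ) * ‖y‖ ^ e) := by ring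

/-- Termwise majorant: `‖c_e yᵉ‖ ≤ 6M·C(e+3,3)‖y‖ᵉ`. [folklore] -/
private theorem norm_coeff_mul_pow_le {c : ℕ → ℂ} {M : ℝ} (hc : ∀ e, ‖c e‖ ≤ M * ((e : ℝ) + 1) ^ 3)
    (y : ℂ) (e : ℕ) : ‖c e * y ^ e‖ ≤ 6 * M * (((e + 3).choose 3 : ℝ) * ‖y‖ ^ e) := by
  have hM : 0 ≤ M := by have := hc 0; simp at this; linarith [norm_nonneg (c 0)]
  rw [norm_mul, norm_pow]
  have h1 := (cube_le_choose e).1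
  have h2 : ‖c e‖ ≤ M * (6 * ((e + 3).choose 3 : ℝ)) := (hc e).trans (by gcongr)
  have h3 : 0 ≤ ‖y‖ ^ e := pow_nonneg (norm_nonneg _) e
  calc ‖c e‖ * ‖y‖ ^ e ≤ (M * (6 * ((e + 3).choose 3 : ℝ))) * ‖y‖ ^ e := mul_le_mul_of_nonneg_right h2 h3
    _ = 6 * M * (((e + 3).choose 3 : ℝ) * ‖y‖ ^ e) := by ring

/-- Tail majorant: `‖c_{e+2} y^{e+2}‖ ≤ 27M‖y‖²·C(e+3,3)‖y‖ᵉ`. [folklore] -/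
private theorem norm_coeff_mul_pow_tail_le {c : ℕ → ℂ} {M : ℝ} (hc : ∀ e, ‖c e‖ ≤ M * ((e : ℝ) + 1) ^ 3)
    (y : ℂ) (e : ℕ) :
    ‖c (e + 2) * y ^ (e + 2)‖ ≤ 27 * M * ‖y‖ ^ 2 * (((e + 3).choose 3 : ℝ) * ‖y‖ ^ e) := by
  have hM : 0 ≤ M := by have := hc 0; simp at this; linarith [norm_nonneg (c 0)]
  rw [norm_mul, norm_pow]
  have h2 := (cube_le_choose e).2
  have hce : ‖c (e + 2)‖ ≤ M * ((e : ℝ) + 3) ^ 3 := by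
    have := hc (e + 2); push_cast at this; rw [show (e : ℝ) + 2 + 1 = e + 3 by ring] at this; exact this
  have hce' : ‖c (e + 2)‖ ≤ M * (27 * ((e + 3).choose 3 : ℝ)) := hce.trans (by gcongr)
  have h3 : 0 ≤ ‖y‖ ^ (e + 2) := pow_nonneg (norm_nonneg _) _
  calc ‖c (e + 2)‖ * ‖y‖ ^ (e + 2) ≤ (M * (27 * ((e + 3).choose 3 : ℝ))) * ‖y‖ ^ (e + 2) :=
        mul_le_mul_of_nonneg_right hce' h3
    _ = 27 * M * ‖y‖ ^ 2 * (((e + 3).choose 3 : ℝ) * ‖y‖ ^ e) := by ring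

/-- `1/(1−r)⁴ ≤ 40` for `0 ≤ r ≤ 3/5`. [folklore] -/
private theorem one_div_pow_four_le {r : ℝ} (hr : r ≤ 3 / 5) : 1 / (1 - r) ^ 4 ≤ 40 := by
  have h25 : (2 / 5 : ℝ) ≤ 1 - r := by linarith
  have hpow : (2 / 5 : ℝ) ^ 4 ≤ (1 - r) ^ 4 := pow_le_pow_left₀ (by norm_num) h25 4
  rw [div_le_iff₀ (lt_of_lt_of_le (by norm_num) hpow)]
  nlinarith

/-- **Size**: `|c_e| ≤ M(e+1)³`, `‖y‖ ≤ 3/5` ⇒ `‖Σ c_e yᵉ‖ ≤ 240M` (`6M/(1−‖y‖)⁴ ≤ 240M`). [folklore] -/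
private theorem norm_tsum_coeff_mul_pow_le {c : ℕ → ℂ} {M : ℝ} (hc : ∀ e, ‖c e‖ ≤ M * ((e : ℝ) + 1) ^ 3)
    {y : ℂ} (hy : ‖y‖ ≤ 3 / 5) : ‖∑' e : ℕ, c e * y ^ e‖ ≤ 240 * M := by
  have hM : 0 ≤ M := by have := hc 0; simp at this; linarith [norm_nonneg (c 0)]
  have hy1 : ‖y‖ < 1 := by linarith
  have hS := hasSum_choose_three (norm_nonneg y) hy1
  have hsum := summable_norm_coeff_mul_pow hc hy1
  have hmaj : Summable fun e : ℕ => 6 * M * (((e + 3).choose 3 : ℝ) * ‖y‖ ^ e) := hS.summable.mul_left _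
  have h1 : ‖∑' e : ℕ, c e * y ^ e‖ ≤ ∑' e : ℕ, ‖c e * y ^ e‖ := norm_tsum_le_tsum_norm hsum
  have h2 : ∑' e : ℕ, ‖c e * y ^ e‖ ≤ ∑' e : ℕ, 6 * M * (((e + 3).choose 3 : ℝ) * ‖y‖ ^ e) :=
    Summable.tsum_le_tsum (fun e => norm_coeff_mul_pow_le hc y e) hsum hmaj
  have h3 : ∑' e : ℕ, 6 * M * (((e + 3).choose 3 : ℝ) * ‖y‖ ^ e) = 6 * M * (1 / (1 - ‖y‖) ^ 4) := by
    rw [tsum_mul_left, hS.tsum_eq]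
  have h4 := one_div_pow_four_le hy
  have h5 : 6 * M * (1 / (1 - ‖y‖) ^ 4) ≤ 6 * M * 40 := mul_le_mul_of_nonneg_left h4 (by positivity)
  have h6 : ‖∑' e : ℕ, c e * y ^ e‖ ≤ 6 * M * 40 := (h1.trans h2).trans (h3.le.trans h5)
  have h7 : (6 : ℝ) * M * 40 = 240 * M := by ring
  rw [h7] at h6
  exact h6

/-- **Second-order tail**: `|c_e| ≤ M(e+1)³`, `‖y‖ ≤ 3/5` ⇒ `‖Σ c_e yᵉ − c₀ − c₁y‖ ≤ 1100M‖y‖²`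
(`Σ_{e≥2} (e+1)³ rᵉ ≤ 27r²/(1−r)⁴`). [folklore] -/
private theorem norm_tsum_coeff_mul_pow_sub_le {c : ℕ → ℂ} {M : ℝ} (hc : ∀ e, ‖c e‖ ≤ M * ((e : ℝ) + 1) ^ 3)
    {y : ℂ} (hy : ‖y‖ ≤ 3 / 5) : ‖∑' e : ℕ, c e * y ^ e - c 0 - c 1 * y‖ ≤ 1100 * M * ‖y‖ ^ 2 := by
  have hM : 0 ≤ M := by have := hc 0; simp at this; linarith [norm_nonneg (c 0)]
  have hy1 : ‖y‖ < 1 := by linarith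
  have hS := hasSum_choose_three (norm_nonneg y) hy1
  have hsum : Summable fun e : ℕ => c e * y ^ e := (summable_norm_coeff_mul_pow hc hy1).of_norm
  -- peel off the first two terms
  have h0 := hsum.tsum_eq_zero_add
  have hsum1 : Summable fun e : ℕ => c (e + 1) * y ^ (e + 1) :=
    (summable_nat_add_iff (f := fun e : ℕ => c e * y ^ e) 1).mpr hsum
  have h1 := hsum1.tsum_eq_zero_add
  have hsum2 : Summable fun e : ℕ => c (e + 2) * y ^ (e + 2) :=
    (summable_nat_add_iff (f := fun e : ℕ => c e * y ^ e) 2).mpr hsum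
  have htail : ∑' e : ℕ, c e * y ^ e - c 0 - c 1 * y = ∑' e : ℕ, c (e + 2) * y ^ (e + 2) := by
    rw [h0, h1]
    have e2 : ∑' e : ℕ, c (e + 1 + 1) * y ^ (e + 1 + 1) = ∑' e : ℕ, c (e + 2) * y ^ (e + 2) :=
      tsum_congr fun e => rfl
    rw [e2, pow_zero, mul_one, zero_add, pow_one]
    ring
  rw [htail]
  have hsum2n : Summable fun e : ℕ => ‖c (e + 2) * y ^ (e + 2)‖ := hsum2.norm
  have hmaj : Summable fun e : ℕ => 27 * M * ‖y‖ ^ 2 * (((e + 3).choose 3 : ℝ) * ‖y‖ ^ e) :=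
    hS.summable.mul_left _
  have e1 : ‖∑' e : ℕ, c (e + 2) * y ^ (e + 2)‖ ≤ ∑' e : ℕ, ‖c (e + 2) * y ^ (e + 2)‖ :=
    norm_tsum_le_tsum_norm hsum2n
  have e2 : ∑' e : ℕ, ‖c (e + 2) * y ^ (e + 2)‖ ≤
      ∑' e : ℕ, 27 * M * ‖y‖ ^ 2 * (((e + 3).choose 3 : ℝ) * ‖y‖ ^ e) :=
    Summable.tsum_le_tsum (fun e => norm_coeff_mul_pow_tail_le hc y e) hsum2n hmaj
  have e3 : ∑' e : ℕ, 27 * M * ‖y‖ ^ 2 * (((e + 3).choose 3 : ℝ) * ‖y‖ ^ e) =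
      27 * M * ‖y‖ ^ 2 * (1 / (1 - ‖y‖) ^ 4) := by rw [tsum_mul_left, hS.tsum_eq]
  have h4 := one_div_pow_four_le hy
  have hMy : 0 ≤ 27 * M * ‖y‖ ^ 2 := by positivity
  have e5 : 27 * M * ‖y‖ ^ 2 * (1 / (1 - ‖y‖) ^ 4) ≤ 27 * M * ‖y‖ ^ 2 * 40 :=
    mul_le_mul_of_nonneg_left h4 hMy
  have e6 : ‖∑' e : ℕ, c (e + 2) * y ^ (e + 2)‖ ≤ 27 * M * ‖y‖ ^ 2 * 40 := (e1.trans e2).trans (e3.le.trans e5)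
  have e7 : 27 * M * ‖y‖ ^ 2 * 40 ≤ 1100 * M * ‖y‖ ^ 2 := by
    have : 27 * M * ‖y‖ ^ 2 * 40 = 1080 * (M * ‖y‖ ^ 2) := by ring
    rw [this, show 1100 * M * ‖y‖ ^ 2 = 1100 * (M * ‖y‖ ^ 2) by ring]
    exact mul_le_mul_of_nonneg_right (by norm_num) (by positivity)
  exact e6.trans e7

/-- **Holomorphy of `s ↦ Σ_e c_e q^{−es}` on `σ > 9/10`** (`q ≥ 2`, `|c_e| ≤ M(e+1)³`): uniform
majorant `M(e+1)³ q^{−9e/10}` (Weierstrass M-test, Mathlib `differentiableOn_tsum_of_summable_norm`). [folklore] -/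
private theorem differentiableOn_tsum_coeff_cpow {c : ℕ → ℂ} {M : ℝ} (hc : ∀ e, ‖c e‖ ≤ M * ((e : ℝ) + 1) ^ 3)
    {q : ℕ} (hq : 2 ≤ q) :
    DifferentiableOn ℂ (fun s : ℂ => ∑' e : ℕ, c e * ((q : ℂ) ^ (-s)) ^ e) {s : ℂ | 9 / 10 < s.re} := by
  have hq0 : (0 : ℝ) < q := by exact_mod_cast (show 0 < q by omega)
  have hq1 : (1 : ℝ) < q := by exact_mod_cast (show 1 < q by omega)
  have hqC : (q : ℂ) ≠ 0 := by exact_mod_cast (show q ≠ 0 by omega)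
  set r : ℝ := (q : ℝ) ^ (-(9 / 10 : ℝ)) with hr
  have hr0 : 0 ≤ r := Real.rpow_nonneg hq0.le _
  have hr1 : r < 1 := Real.rpow_lt_one_of_one_lt_of_neg hq1 (by norm_num)
  have hmaj : Summable fun e : ℕ => ‖c e * (r : ℂ) ^ e‖ :=
    summable_norm_coeff_mul_pow hc (y := (r : ℂ)) (by rw [Complex.norm_real, Real.norm_eq_abs, abs_of_nonneg hr0]; exact hr1)
  refine differentiableOn_tsum_of_summable_norm hmaj (fun e => ?_) (isOpen_lt continuous_const Complex.continuous_re)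
    (fun e s hs => ?_)
  · refine DifferentiableOn.mul (differentiableOn_const _) ?_
    refine DifferentiableOn.pow ?_ e
    exact (differentiableOn_id.neg).const_cpow (Or.inl hqC)
  · have hσ : 9 / 10 < s.re := hs
    rw [norm_mul, norm_mul, norm_pow, norm_pow, Complex.norm_real, Real.norm_eq_abs, abs_of_nonneg hr0,
      Complex.norm_natCast_cpow_of_pos (by omega), Complex.neg_re]
    gcongr
    exact Real.rpow_le_rpow_of_exponent_le hq1.le (by linarith)

end Series

/-! ## §2. The normaliser polynomial `N_q = (1−x)²(1−wx)(1−vx)(1−vwx)²` -/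

section Normaliser

/-- `‖∏_{i∈s}(1 + y_i) − 1 − Σ y_i‖ ≤ (1+t)^{#s} − 1 − #s·t` and `‖∏(1 + y_i) − 1‖ ≤ (1+t)^{#s} − 1` when
`‖y_i‖ ≤ t`. [folklore] -/
private theorem norm_prod_one_add_sub_le {ι : Type*} [DecidableEq ι] (s : Finset ι) (y : ι → ℂ) {t : ℝ}
    (ht : 0 ≤ t) (hy : ∀ i ∈ s, ‖y i‖ ≤ t) :
    ‖∏ i ∈ s, (1 + y i) - 1‖ ≤ (1 + t) ^ s.card - 1 ∧
      ‖∏ i ∈ s, (1 + y i) - 1 - ∑ i ∈ s, y i‖ ≤ (1 + t) ^ s.card - 1 - s.card * t := by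
  induction s using Finset.induction_on with
  | empty => simp
  | insert a s has ih =>
    have hy' : ∀ i ∈ s, ‖y i‖ ≤ t := fun i hi => hy i (Finset.mem_insert_of_mem hi)
    have hya : ‖y a‖ ≤ t := hy a (Finset.mem_insert_self a s)
    obtain ⟨ih1, ih2⟩ := ih hy'
    rw [Finset.prod_insert has, Finset.sum_insert has, Finset.card_insert_of_notMem has]
    set P := ∏ i ∈ s, (1 + y i) with hP
    set S := ∑ i ∈ s, y i with hS
    have hpow : 0 ≤ (1 + t) ^ s.card - 1 := by
      have := one_le_pow₀ (show (1 : ℝ) ≤ 1 + t by linarith) (n := s.card); linarith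
    constructor
    · have e : (1 + y a) * P - 1 = (P - 1) + y a * P := by ring
      rw [e]
      have hPn : ‖P‖ ≤ (1 + t) ^ s.card := by
        have := norm_sub_norm_le P 1; rw [norm_one] at this; linarith
      calc ‖P - 1 + y a * P‖ ≤ ‖P - 1‖ + ‖y a‖ * ‖P‖ := by rw [← norm_mul]; exact norm_add_le _ _
        _ ≤ ((1 + t) ^ s.card - 1) + t * (1 + t) ^ s.card := by gcongr
        _ = (1 + t) ^ (s.card + 1) - 1 := by ring
    · have e : (1 + y a) * P - 1 - (y a + S) = (P - 1 - S) + y a * (P - 1) := by ring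
      rw [e]
      calc ‖P - 1 - S + y a * (P - 1)‖ ≤ ‖P - 1 - S‖ + ‖y a‖ * ‖P - 1‖ := by
            rw [← norm_mul]; exact norm_add_le _ _
        _ ≤ ((1 + t) ^ s.card - 1 - s.card * t) + t * ((1 + t) ^ s.card - 1) := by gcongr
        _ = (1 + t) ^ (s.card + 1) - 1 - ((s.card + 1 : ℕ) : ℝ) * t := by push_cast; ring

/-- **The normaliser polynomial**: for `‖x‖ ≤ 3/5`, `‖w‖ = 1`, `‖v‖ ≤ 1`,
`‖N‖ ≤ 17` and `‖N − 1 + (2 + w + v + 2vw)x‖ ≤ 35‖x‖²`, `N = (1−x)²(1−wx)(1−vx)(1−vwx)²`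
(the six factors are `1 + y` with `|y| ≤ |x|`; `(1+t)⁶ − 1 − 6t ≤ 35t²` for `t ≤ 3/5`).
[cite: Zhang2022LandauSiegel, §16 Lemma 16.2 p.94] -/
theorem norm_normPoly_le {x w v : ℂ} (hx : ‖x‖ ≤ 3 / 5) (hw : ‖w‖ = 1) (hv : ‖v‖ ≤ 1) :
    ‖(1 - x) ^ 2 * (1 - w * x) * (1 - v * x) * (1 - v * (w * x)) ^ 2‖ ≤ 17 ∧
      ‖(1 - x) ^ 2 * (1 - w * x) * (1 - v * x) * (1 - v * (w * x)) ^ 2 - 1 + (2 + w + v + 2 * v * w) * x‖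
        ≤ 35 * ‖x‖ ^ 2 := by
  set y : Fin 6 → ℂ := ![-x, -x, -(w * x), -(v * x), -(v * (w * x)), -(v * (w * x))] with hydef
  have hprod : ∏ i : Fin 6, (1 + y i) = (1 - x) ^ 2 * (1 - w * x) * (1 - v * x) * (1 - v * (w * x)) ^ 2 := by
    simp only [Fin.prod_univ_succ, Fin.prod_univ_zero, hydef]
    simp
    ring
  have hsum : ∑ i : Fin 6, y i = -((2 + w + v + 2 * v * w) * x) := by
    simp only [Fin.sum_univ_succ, Fin.sum_univ_zero, hydef]
    simp
    ring
  have hvw : ‖v * (w * x)‖ ≤ ‖x‖ := by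
    rw [norm_mul, norm_mul, hw, one_mul]; nlinarith [norm_nonneg v, norm_nonneg x]
  have hy : ∀ i ∈ (Finset.univ : Finset (Fin 6)), ‖y i‖ ≤ ‖x‖ := by
    intro i _
    fin_cases i <;> simp [hydef, hw] <;> nlinarith [norm_nonneg v, norm_nonneg x, hv]
  obtain ⟨h1, h2⟩ := norm_prod_one_add_sub_le (Finset.univ : Finset (Fin 6)) y (norm_nonneg x) hy
  rw [Finset.card_univ, Fintype.card_fin, hprod] at h1 h2
  rw [hsum] at h2
  have ht : ‖x‖ ≤ 3 / 5 := hx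
  have ht0 := norm_nonneg x
  constructor
  · have : (1 + ‖x‖) ^ 6 ≤ 17 := by nlinarith [pow_le_pow_left₀ (by linarith : (0:ℝ) ≤ 1 + ‖x‖) (by linarith : 1 + ‖x‖ ≤ 8 / 5) 6]
    have := norm_sub_norm_le ((1 - x) ^ 2 * (1 - w * x) * (1 - v * x) * (1 - v * (w * x)) ^ 2) 1
    rw [norm_one] at this
    linarith
  · rw [show (1 - x) ^ 2 * (1 - w * x) * (1 - v * x) * (1 - v * (w * x)) ^ 2 - 1 + (2 + w + v + 2 * v * w) * x =
      (1 - x) ^ 2 * (1 - w * x) * (1 - v * x) * (1 - v * (w * x)) ^ 2 - 1 - -((2 + w + v + 2 * v * w) * x) by ring]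
    refine h2.trans ?_
    push_cast
    nlinarith [pow_nonneg ht0 3, pow_nonneg ht0 4, mul_nonneg ht0 ht0]

end Normaliser

/-! ## §3. The Euler factor `Φ_q = N_q·C_q` of `E₂ⱼ` -/

section Factor

variable (c' : ℝ) {D : ℕ} [NeZero D] (χ : DirichletCharacter ℂ D) (j : ℕ)

/-- **Coefficient bound at an odd prime**: `‖ϖ₂ⱼ^loc(q^e)(ν∗χ)(q^e)‖ ≤ 2100(e+1)³` when
`‖F_q(1,1;1−β_j)‖ ≥ 1/2`. [cite: Zhang2022LandauSiegel, §16 p.93] -/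
theorem norm_coeff_le {q : ℕ} (hq : q.Prime) (hF : 1 / 2 ≤ ‖calM2Factor c' χ q 1 1 (1 - betaJ c' D j)‖)
    (e : ℕ) : ‖varpi2loc c' χ j (q ^ e) * nuConvChi χ (q ^ e)‖ ≤ 2100 * ((e : ℝ) + 1) ^ 3 := by
  rw [norm_mul]
  calc ‖varpi2loc c' χ j (q ^ e)‖ * ‖nuConvChi χ (q ^ e)‖ ≤ (2100 * ((e : ℝ) + 1)) * ((e : ℝ) + 1) ^ 2 :=
        mul_le_mul (norm_varpi2loc_prime_pow_le c' χ hq e j hF) (norm_nuConvChi_prime_pow_le χ hq e)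
          (norm_nonneg _) (by positivity)
    _ = 2100 * ((e : ℝ) + 1) ^ 3 := by ring

omit [NeZero D] in
/-- **Coefficient bound at `2` (global `ϖ₂ⱼ`)**: `‖ϖ₂ⱼ(2^e)(ν∗χ)(2^e)‖ ≤ B(e+1)³` under (H2).
[cite: Zhang2022LandauSiegel, §16 p.93] -/
theorem norm_coeff_two_le {B : ℝ} (hB : ∀ e : ℕ, ‖varpi2 c' χ j (2 ^ e)‖ ≤ B * ((e : ℝ) + 1)) (e : ℕ) :
    ‖varpi2 c' χ j (2 ^ e) * nuConvChi χ (2 ^ e)‖ ≤ B * ((e : ℝ) + 1) ^ 3 := by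
  have hB0 : 0 ≤ B := by have := hB 0; simp at this; linarith [norm_nonneg (varpi2 c' χ j 1)]
  rw [norm_mul]
  calc ‖varpi2 c' χ j (2 ^ e)‖ * ‖nuConvChi χ (2 ^ e)‖ ≤ (B * ((e : ℝ) + 1)) * ((e : ℝ) + 1) ^ 2 :=
        mul_le_mul (hB e) (norm_nuConvChi_prime_pow_le χ Nat.prime_two e) (norm_nonneg _) (by positivity)
    _ = B * ((e : ℝ) + 1) ^ 3 := by ring

omit [NeZero D] in
/-- On `σ > 9/10`: `‖q^{−s}‖ ≤ 3/5`, and `‖q^{β_j}‖ = 1`. [cite: Zhang2022LandauSiegel, §16 p.94] -/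
theorem norm_x_w {q : ℕ} (hq : q.Prime) {s : ℂ} (hs : 9 / 10 < s.re) :
    ‖(q : ℂ) ^ (-s)‖ ≤ 3 / 5 ∧ ‖(q : ℂ) ^ (-s)‖ = (q : ℝ) ^ (-s.re) ∧ ‖(q : ℂ) ^ betaJ c' D j‖ = 1 := by
  obtain ⟨e, h⟩ := norm_cpow_neg_le_three_fifths hq.two_le hs.le
  refine ⟨h, e, ?_⟩
  rw [Complex.norm_natCast_cpow_of_pos hq.pos, betaJ_re_eq_zero, Real.rpow_zero]

/-- **`C_q(s)` is holomorphic on `σ > 9/10`** (odd prime `q` with `‖F_q(1,1;1−β_j)‖ ≥ 1/2`).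
[cite: Zhang2022LandauSiegel, §16 Lemma 16.2 p.94] -/
theorem differentiableOn_Cq {q : ℕ} (hq : q.Prime)
    (hF : 1 / 2 ≤ ‖calM2Factor c' χ q 1 1 (1 - betaJ c' D j)‖) :
    DifferentiableOn ℂ (fun s : ℂ => ∑' e : ℕ, varpi2loc c' χ j (q ^ e) * nuConvChi χ (q ^ e) * ((q : ℂ) ^ (-s)) ^ e)
      {s : ℂ | 9 / 10 < s.re} :=
  differentiableOn_tsum_coeff_cpow (c := fun e => varpi2loc c' χ j (q ^ e) * nuConvChi χ (q ^ e))
    (norm_coeff_le c' χ j hq hF) hq.two_le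

omit [NeZero D] in
/-- **`C_2(s)` is holomorphic on `σ > 9/10`** (under (H2)). [cite: Zhang2022LandauSiegel, §16 Lemma 16.2 p.94] -/
theorem differentiableOn_C2 {B : ℝ} (hB : ∀ e : ℕ, ‖varpi2 c' χ j (2 ^ e)‖ ≤ B * ((e : ℝ) + 1)) :
    DifferentiableOn ℂ (fun s : ℂ => ∑' e : ℕ, varpi2 c' χ j (2 ^ e) * nuConvChi χ (2 ^ e) * ((2 : ℂ) ^ (-s)) ^ e)
      {s : ℂ | 9 / 10 < s.re} := by
  have h := differentiableOn_tsum_coeff_cpow (c := fun e => varpi2 c' χ j (2 ^ e) * nuConvChi χ (2 ^ e))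
    (norm_coeff_two_le c' χ j hB) (le_refl 2)
  simpa using h

omit [NeZero D] in
/-- **`N_q(s)` is entire** (a polynomial in `q^{−s}`). [cite: Zhang2022LandauSiegel, §16 Lemma 16.2 p.94] -/
theorem differentiable_Nq {q : ℕ} (hq : q.Prime) :
    Differentiable ℂ (fun s : ℂ =>
      (1 - (q : ℂ) ^ (-s)) ^ 2 * (1 - (q : ℂ) ^ betaJ c' D j * (q : ℂ) ^ (-s)) *
        (1 - χ (q : ZMod D) * (q : ℂ) ^ (-s)) * (1 - χ (q : ZMod D) * ((q : ℂ) ^ betaJ c' D j * (q : ℂ) ^ (-s))) ^ 2) := by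
  have hqC : (q : ℂ) ≠ 0 := by exact_mod_cast hq.ne_zero
  have hx : Differentiable ℂ (fun s : ℂ => (q : ℂ) ^ (-s)) := differentiable_id.neg.const_cpow (Or.inl hqC)
  exact ((((differentiable_const _).sub hx).pow 2).mul ((differentiable_const _).sub
    ((differentiable_const _).mul hx))).mul ((differentiable_const _).sub ((differentiable_const _).mul hx))
    |>.mul (((differentiable_const _).sub ((differentiable_const _).mul ((differentiable_const _).mul hx))).pow 2)

/-- **Size of `C_q` and of `Φ_q` on `σ > 9/10`** for an odd prime with `‖F_q(1,1;1−β_j)‖ ≥ 1/2`: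
`‖C_q(s)‖ ≤ 504000` and `‖Φ_q(s) − 1‖ ≤ 8568001`. [cite: Zhang2022LandauSiegel, §16 Lemma 16.2 p.94] -/
theorem norm_Phi_sub_one_le_crude {q : ℕ} (hq : q.Prime)
    (hF : 1 / 2 ≤ ‖calM2Factor c' χ q 1 1 (1 - betaJ c' D j)‖) {s : ℂ} (hs : 9 / 10 < s.re) :
    ‖(1 - (q : ℂ) ^ (-s)) ^ 2 * (1 - (q : ℂ) ^ betaJ c' D j * (q : ℂ) ^ (-s)) *
          (1 - χ (q : ZMod D) * (q : ℂ) ^ (-s)) * (1 - χ (q : ZMod D) * ((q : ℂ) ^ betaJ c' D j * (q : ℂ) ^ (-s))) ^ 2 *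
        (∑' e : ℕ, varpi2loc c' χ j (q ^ e) * nuConvChi χ (q ^ e) * ((q : ℂ) ^ (-s)) ^ e) - 1‖ ≤ 8568001 := by
  obtain ⟨hx, -, hw⟩ := norm_x_w c' j hq hs
  have hN := (norm_normPoly_le hx hw (χ.norm_le_one (q : ZMod D))).1
  have hC := norm_tsum_coeff_mul_pow_le (norm_coeff_le c' χ j hq hF) hx
  calc _ ≤ ‖(1 - (q : ℂ) ^ (-s)) ^ 2 * (1 - (q : ℂ) ^ betaJ c' D j * (q : ℂ) ^ (-s)) *
          (1 - χ (q : ZMod D) * (q : ℂ) ^ (-s)) * (1 - χ (q : ZMod D) * ((q : ℂ) ^ betaJ c' D j * (q : ℂ) ^ (-s))) ^ 2 *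
        (∑' e : ℕ, varpi2loc c' χ j (q ^ e) * nuConvChi χ (q ^ e) * ((q : ℂ) ^ (-s)) ^ e)‖ + ‖(1 : ℂ)‖ :=
        norm_sub_le _ _
    _ ≤ 17 * (240 * 2100) + 1 := by
        rw [norm_mul, norm_one]
        exact add_le_add (mul_le_mul hN hC (norm_nonneg _) (by norm_num)) le_rfl
    _ = 8568001 := by norm_num

omit [NeZero D] in
/-- **Size of `Φ_2` on `σ > 9/10`** under (H2): `‖Φ_2(s) − 1‖ ≤ 4080B + 1`.
[cite: Zhang2022LandauSiegel, §16 Lemma 16.2 p.94] -/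
theorem norm_Phi_two_sub_one_le_crude {B : ℝ} (hB : ∀ e : ℕ, ‖varpi2 c' χ j (2 ^ e)‖ ≤ B * ((e : ℝ) + 1))
    {s : ℂ} (hs : 9 / 10 < s.re) :
    ‖(1 - (2 : ℂ) ^ (-s)) ^ 2 * (1 - (2 : ℂ) ^ betaJ c' D j * (2 : ℂ) ^ (-s)) *
          (1 - χ (2 : ZMod D) * (2 : ℂ) ^ (-s)) * (1 - χ (2 : ZMod D) * ((2 : ℂ) ^ betaJ c' D j * (2 : ℂ) ^ (-s))) ^ 2 *
        (∑' e : ℕ, varpi2 c' χ j (2 ^ e) * nuConvChi χ (2 ^ e) * ((2 : ℂ) ^ (-s)) ^ e) - 1‖ ≤ 4080 * B + 1 := by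
  obtain ⟨hx, -, hw⟩ := norm_x_w c' (D := D) j Nat.prime_two hs
  push_cast at hx hw
  have hv : ‖χ (2 : ZMod D)‖ ≤ 1 := χ.norm_le_one _
  have hN := (norm_normPoly_le hx hw hv).1
  have hC := norm_tsum_coeff_mul_pow_le (norm_coeff_two_le c' χ j hB) hx
  have hB0 : 0 ≤ B := by have := hB 0; simp at this; linarith [norm_nonneg (varpi2 c' χ j 1)]
  calc _ ≤ ‖(1 - (2 : ℂ) ^ (-s)) ^ 2 * (1 - (2 : ℂ) ^ betaJ c' D j * (2 : ℂ) ^ (-s)) *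
          (1 - χ (2 : ZMod D) * (2 : ℂ) ^ (-s)) * (1 - χ (2 : ZMod D) * ((2 : ℂ) ^ betaJ c' D j * (2 : ℂ) ^ (-s))) ^ 2 *
        (∑' e : ℕ, varpi2 c' χ j (2 ^ e) * nuConvChi χ (2 ^ e) * ((2 : ℂ) ^ (-s)) ^ e)‖ + ‖(1 : ℂ)‖ :=
        norm_sub_le _ _
    _ ≤ 17 * (240 * B) + 1 := by
        rw [norm_mul, norm_one]
        exact add_le_add (mul_le_mul hN hC (norm_nonneg _) (by norm_num)) le_rfl
    _ = 4080 * B + 1 := by ring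

end Factor

/-! ## §4. `Φ_q = 1 + O(q^{−1−σ} + q^{−2σ})` at the primes with `χ(q) = ±1`, `q ≥ 700` -/

section Generic

variable (c' : ℝ) {D : ℕ} [NeZero D] (χ : DirichletCharacter ℂ D) (j : ℕ)

omit [NeZero D] in
/-- **`ρ = F_q(d,l;1−β_j)/F_q(1,1;1−β_j) = 1 + O(q⁻¹)`**: `‖locRatio − 1‖ ≤ 1400/q` for `q ≥ 700`
(both factors are within `350/q` of `1`, the denominator has norm `≥ 1/2`).
[cite: Zhang2022LandauSiegel, §16 p.93, App. A p.105] -/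
theorem norm_locRatio_sub_one_le {q : ℕ} (hq : q.Prime) (h700 : 700 ≤ q) (d l : ℕ) :
    ‖locRatio c' χ q d l (1 - betaJ c' D j) - 1‖ ≤ 1400 / q := by
  have hq0 : (0 : ℝ) < q := by exact_mod_cast hq.pos
  have hF := half_le_norm_calM2Factor_betaJ_of_le c' χ hq h700 1 1 j
  have hF0 : calM2Factor c' χ q 1 1 (1 - betaJ c' D j) ≠ 0 := by
    intro h; rw [h, norm_zero] at hF; linarith
  have h1 := norm_calM2Factor_betaJ_sub_one_le c' χ hq d l j
  have h2 := norm_calM2Factor_betaJ_sub_one_le c' χ hq 1 1 j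
  unfold locRatio
  rw [div_sub_one hF0, norm_div, div_le_div_iff₀ (by linarith) hq0]
  have h3 : ‖calM2Factor c' χ q d l (1 - betaJ c' D j) - calM2Factor c' χ q 1 1 (1 - betaJ c' D j)‖ ≤ 700 / q := by
    rw [show calM2Factor c' χ q d l (1 - betaJ c' D j) - calM2Factor c' χ q 1 1 (1 - betaJ c' D j) =
      (calM2Factor c' χ q d l (1 - betaJ c' D j) - 1) - (calM2Factor c' χ q 1 1 (1 - betaJ c' D j) - 1) by ring]
    calc _ ≤ ‖calM2Factor c' χ q d l (1 - betaJ c' D j) - 1‖ + ‖calM2Factor c' χ q 1 1 (1 - betaJ c' D j) - 1‖ :=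
          norm_sub_le _ _
      _ ≤ 350 / q + 350 / q := add_le_add h1 h2
      _ = 700 / q := by ring
  calc _ ≤ 700 / (q : ℝ) * q := by gcongr
    _ = 700 := by field_simp
    _ ≤ 1400 * ‖calM2Factor c' χ q 1 1 (1 - betaJ c' D j)‖ := by linarith

omit [NeZero D] in
/-- **`λ₂(q) = 1 + O(q⁻¹)`**: `‖λ₂(q,1) − 1‖ ≤ 4/q` (`λ₂(q,1) = (1−χ(q)q^{−1−β₁})/(1−χ(q)q⁻¹)`).
[cite: Zhang2022LandauSiegel, §16 p.90 (u014)] -/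
theorem norm_lam2_one_sub_one_le {q : ℕ} (hq : q.Prime) : ‖lam2 c' χ q 1 - 1‖ ≤ 4 / q := by
  have hq2 : (2 : ℝ) ≤ q := by exact_mod_cast hq.two_le
  have hq0 : (0 : ℝ) < q := by linarith
  have hqC : (q : ℂ) ≠ 0 := by exact_mod_cast hq.ne_zero
  rw [Typed.Section16ALeaves.lam2_prime c' χ hq 1]
  set v : ℂ := χ (q : ZMod D) with hvdef
  have hv : ‖v‖ ≤ 1 := χ.norm_le_one _
  have ha : ‖(q : ℂ) ^ (-((1 : ℂ) + beta1 c' D))‖ = (q : ℝ)⁻¹ := by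
    rw [Complex.norm_natCast_cpow_of_pos hq.pos]; simp [beta1_eq_b1_mul_I, Real.rpow_neg_one]
  have hb : ‖(q : ℂ) ^ (-(1 : ℂ))‖ = (q : ℝ)⁻¹ := by
    rw [Complex.norm_natCast_cpow_of_pos hq.pos]; simp [Real.rpow_neg_one]
  have hqinv : (q : ℝ)⁻¹ ≤ 1 / 2 := inv_le_of_inv_le₀ (by norm_num) (by linarith)
  have hden : 1 / 2 ≤ ‖1 - v * (q : ℂ) ^ (-(1 : ℂ))‖ := by
    have h := norm_sub_norm_le (1 : ℂ) (v * (q : ℂ) ^ (-(1 : ℂ)))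
    rw [norm_one, norm_mul, hb] at h
    nlinarith [norm_nonneg v]
  have hden0 : 1 - v * (q : ℂ) ^ (-(1 : ℂ)) ≠ 0 := by
    intro h; rw [h, norm_zero] at hden; linarith
  rw [div_sub_one hden0, norm_div, div_le_div_iff₀ (by linarith) hq0]
  have hnum : ‖1 - v * (q : ℂ) ^ (-((1 : ℂ) + beta1 c' D)) - (1 - v * (q : ℂ) ^ (-(1 : ℂ)))‖ ≤ 2 * (q : ℝ)⁻¹ := by
    rw [show 1 - v * (q : ℂ) ^ (-((1 : ℂ) + beta1 c' D)) - (1 - v * (q : ℂ) ^ (-(1 : ℂ))) =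
      v * (q : ℂ) ^ (-(1 : ℂ)) - v * (q : ℂ) ^ (-((1 : ℂ) + beta1 c' D)) by ring]
    calc _ ≤ ‖v * (q : ℂ) ^ (-(1 : ℂ))‖ + ‖v * (q : ℂ) ^ (-((1 : ℂ) + beta1 c' D))‖ := norm_sub_le _ _
      _ ≤ (q : ℝ)⁻¹ + (q : ℝ)⁻¹ := by
          rw [norm_mul, norm_mul, ha, hb]
          have hqi : 0 ≤ (q : ℝ)⁻¹ := by positivity
          exact add_le_add (by nlinarith [norm_nonneg v]) (by nlinarith [norm_nonneg v])
      _ = 2 * (q : ℝ)⁻¹ := by ring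
  calc _ ≤ 2 * (q : ℝ)⁻¹ * q := by gcongr
    _ = 2 := by field_simp
    _ ≤ 4 * ‖1 - v * (q : ℂ) ^ (-(1 : ℂ))‖ := by linarith

omit [NeZero D] in
/-- **The linear coefficient of `C_q`**: `c₁ = ϖ₂ⱼ^loc(q)(ν∗χ)(q) = (χ(q)ρ₀₁ + λ₂(q)q^{β_j}ρ₁₀)(1 + 2χ(q))`,
`ρ₀₁ = F_q(1,q)/F_q(1,1)`, `ρ₁₀ = F_q(q,1)/F_q(1,1)` at `1−β_j`. [cite: Zhang2022LandauSiegel, §16 p.93] -/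
theorem coeff_one_eq {q : ℕ} (hq : q.Prime) :
    varpi2loc c' χ j (q ^ 1) * nuConvChi χ (q ^ 1) =
      (χ (q : ZMod D) * locRatio c' χ q 1 q (1 - betaJ c' D j) +
        lam2 c' χ q 1 * (q : ℂ) ^ betaJ c' D j * locRatio c' χ q q 1 (1 - betaJ c' D j)) *
      (1 + 2 * χ (q : ZMod D)) := by
  rw [varpi2loc_prime_pow c' χ hq one_ne_zero j, pow_one, nuConvChi_prime χ hq]
  rw [Finset.sum_range_succ, Finset.sum_range_one]
  simp only [pow_zero, pow_one, Nat.sub_zero, Nat.sub_self, Nat.cast_one, one_cpow, mul_one]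
  have h1 : lam2 c' χ 1 1 = 1 := by unfold lam2; rw [Nat.primeFactors_one, Finset.prod_empty]
  rw [h1]
  ring

omit [NeZero D] in
/-- **Cancellation of the linear coefficients** (`χ(q) = ±1`, `q ≥ 700`):
`‖c₁ − (2 + w + v + 2vw)‖ ≤ 8500/q` where `w = q^{β_j}`, `v = χ(q)` — since
`c₁ − (2+w+v+2vw) = (λ₂ρ₁₀ − 1)(w + 2vw) + (ρ₀₁ − 1)(v + 2)` when `v² = 1`. This is the reason `E₂ⱼ`'s Euler
factor is `1 + O(q^{−19/10})` on `σ > 9/10` (App. A p. 105). [cite: Zhang2022LandauSiegel, App. A p.105] -/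
theorem norm_coeff_one_sub_le {q : ℕ} (hq : q.Prime) (h700 : 700 ≤ q)
    (hv : χ (q : ZMod D) = 1 ∨ χ (q : ZMod D) = -1) :
    ‖varpi2loc c' χ j (q ^ 1) * nuConvChi χ (q ^ 1) -
        (2 + (q : ℂ) ^ betaJ c' D j + χ (q : ZMod D) + 2 * χ (q : ZMod D) * (q : ℂ) ^ betaJ c' D j)‖ ≤ 8500 / q := by
  have hq0 : (0 : ℝ) < q := by exact_mod_cast hq.pos
  have h700' : (700 : ℝ) ≤ q := by exact_mod_cast h700
  set v : ℂ := χ (q : ZMod D) with hvdef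
  set w : ℂ := (q : ℂ) ^ betaJ c' D j with hwdef
  set ρ01 : ℂ := locRatio c' χ q 1 q (1 - betaJ c' D j) with h01
  set ρ10 : ℂ := locRatio c' χ q q 1 (1 - betaJ c' D j) with h10
  set lam : ℂ := lam2 c' χ q 1 with hlam
  have hw : ‖w‖ = 1 := by
    rw [hwdef, Complex.norm_natCast_cpow_of_pos hq.pos, betaJ_re_eq_zero, Real.rpow_zero]
  have hv1 : ‖v‖ ≤ 1 := χ.norm_le_one _
  rw [coeff_one_eq c' χ j hq]
  have hid : (v * ρ01 + lam * w * ρ10) * (1 + 2 * v) - (2 + w + v + 2 * v * w) =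
      (lam * ρ10 - 1) * (w + 2 * v * w) + (ρ01 - 1) * (v + 2) := by
    rcases hv with h | h
    · rw [h]; ring
    · rw [h]; ring
  rw [hid]
  have hA : ‖ρ10 - 1‖ ≤ 1400 / q := norm_locRatio_sub_one_le c' χ j hq h700 q 1
  have hB : ‖ρ01 - 1‖ ≤ 1400 / q := norm_locRatio_sub_one_le c' χ j hq h700 1 q
  have hL : ‖lam - 1‖ ≤ 4 / q := norm_lam2_one_sub_one_le c' χ hq
  have h1400 : (1400 : ℝ) / q ≤ 2 := by rw [div_le_iff₀ hq0]; linarith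
  have hρ10 : ‖ρ10‖ ≤ 3 := by
    have := norm_sub_norm_le ρ10 1; rw [norm_one] at this; linarith
  have hC : ‖lam * ρ10 - 1‖ ≤ 1412 / q := by
    rw [show lam * ρ10 - 1 = (lam - 1) * ρ10 + (ρ10 - 1) by ring]
    calc _ ≤ ‖lam - 1‖ * ‖ρ10‖ + ‖ρ10 - 1‖ := by rw [← norm_mul]; exact norm_add_le _ _
      _ ≤ (4 / q) * 3 + 1400 / q := add_le_add (mul_le_mul hL hρ10 (norm_nonneg _) (by positivity)) hA
      _ = 1412 / q := by ring
  have hw3 : ‖w + 2 * v * w‖ ≤ 3 := by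
    calc _ ≤ ‖w‖ + ‖2 * v * w‖ := norm_add_le _ _
      _ ≤ 1 + 2 := by
          rw [hw, norm_mul, norm_mul, hw, Complex.norm_two]
          exact add_le_add le_rfl (by nlinarith)
      _ = 3 := by norm_num
  have hv3 : ‖v + 2‖ ≤ 3 := by
    calc _ ≤ ‖v‖ + ‖(2 : ℂ)‖ := norm_add_le _ _
      _ ≤ 1 + 2 := by rw [Complex.norm_two]; exact add_le_add hv1 le_rfl
      _ = 3 := by norm_num
  calc ‖(lam * ρ10 - 1) * (w + 2 * v * w) + (ρ01 - 1) * (v + 2)‖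
      ≤ ‖lam * ρ10 - 1‖ * ‖w + 2 * v * w‖ + ‖ρ01 - 1‖ * ‖v + 2‖ := by
        rw [← norm_mul, ← norm_mul]; exact norm_add_le _ _
    _ ≤ (1412 / q) * 3 + (1400 / q) * 3 :=
        add_le_add (mul_le_mul hC hw3 (norm_nonneg _) (by positivity))
          (mul_le_mul hB hv3 (norm_nonneg _) (by positivity))
    _ ≤ 8500 / q := by rw [div_mul_eq_mul_div, div_mul_eq_mul_div, ← add_div]; gcongr; norm_num

/-- **`Φ_q(s) = 1 + O(q^{−1−σ} + q^{−2σ})` for `χ(q) = ±1`, `q ≥ 700`, `σ > 9/10`**: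
`‖N_q(s)C_q(s) − 1‖ ≤ 8500‖q^{−s}‖/q + 3·10⁷‖q^{−s}‖²`
(`N C − 1 = N₂C + (c₁ − n₁)x − n₁c₁x² − n₁xC₂ + C₂` with `N = 1 − n₁x + N₂`, `C = 1 + c₁x + C₂`).
[cite: Zhang2022LandauSiegel, §16 Lemma 16.2 p.94, App. A p.105] -/
theorem norm_Phi_sub_one_le {q : ℕ} (hq : q.Prime) (h700 : 700 ≤ q)
    (hv : χ (q : ZMod D) = 1 ∨ χ (q : ZMod D) = -1) {s : ℂ} (hs : 9 / 10 < s.re) :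
    ‖(1 - (q : ℂ) ^ (-s)) ^ 2 * (1 - (q : ℂ) ^ betaJ c' D j * (q : ℂ) ^ (-s)) *
          (1 - χ (q : ZMod D) * (q : ℂ) ^ (-s)) * (1 - χ (q : ZMod D) * ((q : ℂ) ^ betaJ c' D j * (q : ℂ) ^ (-s))) ^ 2 *
        (∑' e : ℕ, varpi2loc c' χ j (q ^ e) * nuConvChi χ (q ^ e) * ((q : ℂ) ^ (-s)) ^ e) - 1‖
      ≤ 8500 * ‖(q : ℂ) ^ (-s)‖ / q + 30000000 * ‖(q : ℂ) ^ (-s)‖ ^ 2 := by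
  have hq0 : (0 : ℝ) < q := by exact_mod_cast hq.pos
  have hF := half_le_norm_calM2Factor_betaJ_of_le c' χ hq h700 1 1 j
  obtain ⟨hx, -, hw⟩ := norm_x_w c' j hq hs
  set x : ℂ := (q : ℂ) ^ (-s) with hxdef
  set w : ℂ := (q : ℂ) ^ betaJ c' D j with hwdef
  set v : ℂ := χ (q : ZMod D) with hvdef
  have hv1 : ‖v‖ ≤ 1 := χ.norm_le_one _
  set c : ℕ → ℂ := fun e => varpi2loc c' χ j (q ^ e) * nuConvChi χ (q ^ e) with hcdef
  have hc : ∀ e, ‖c e‖ ≤ 2100 * ((e : ℝ) + 1) ^ 3 := fun e => norm_coeff_le c' χ j hq hF e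
  set C : ℂ := ∑' e : ℕ, c e * x ^ e with hCdef
  set N : ℂ := (1 - x) ^ 2 * (1 - w * x) * (1 - v * x) * (1 - v * (w * x)) ^ 2 with hNdef
  set n₁ : ℂ := 2 + w + v + 2 * v * w with hn1
  obtain ⟨hNle, hN2⟩ := norm_normPoly_le hx hw hv1
  have hC0 : c 0 = 1 := by simp [hcdef, varpi2loc_one, nuConvChi_one]
  have hCle : ‖C‖ ≤ 240 * 2100 := norm_tsum_coeff_mul_pow_le hc hx
  have hC2 : ‖C - c 0 - c 1 * x‖ ≤ 1100 * 2100 * ‖x‖ ^ 2 := norm_tsum_coeff_mul_pow_sub_le hc hx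
  rw [hC0] at hC2
  have hc1n : ‖c 1 - n₁‖ ≤ 8500 / q := by
    have h := norm_coeff_one_sub_le c' χ j hq h700 hv
    simpa [hcdef, hn1] using h
  have hc1 : ‖c 1‖ ≤ 16800 := by have := hc 1; norm_num at this; exact this
  have hn1le : ‖n₁‖ ≤ 6 := by
    rw [hn1]
    calc _ ≤ ‖2 + w + v‖ + ‖2 * v * w‖ := norm_add_le _ _
      _ ≤ (‖(2 : ℂ) + w‖ + ‖v‖) + ‖2 * v * w‖ := by gcongr; exact norm_add_le _ _
      _ ≤ ((‖(2 : ℂ)‖ + ‖w‖) + ‖v‖) + ‖2 * v * w‖ := by gcongr; exact norm_add_le _ _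
      _ ≤ ((2 + 1) + 1) + 2 := by
          rw [Complex.norm_two, hw, norm_mul, norm_mul, Complex.norm_two, hw]
          gcongr
          nlinarith
      _ = 6 := by norm_num
  -- the decomposition
  set C₂ : ℂ := C - 1 - c 1 * x with hC2def
  set N₂ : ℂ := N - 1 + n₁ * x with hN2def
  have hdecomp : N * C - 1 = N₂ * C + (c 1 - n₁) * x - n₁ * c 1 * x ^ 2 - n₁ * x * C₂ + C₂ := by
    rw [hC2def, hN2def]; ring
  have hN2' : ‖N₂‖ ≤ 35 * ‖x‖ ^ 2 := hN2
  have hxn := norm_nonneg x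
  have t1 : ‖N₂ * C‖ ≤ 35 * ‖x‖ ^ 2 * (240 * 2100) := by
    rw [norm_mul]; exact mul_le_mul hN2' hCle (norm_nonneg _) (by positivity)
  have t2 : ‖(c 1 - n₁) * x‖ ≤ 8500 / q * ‖x‖ := by
    rw [norm_mul]; exact mul_le_mul_of_nonneg_right hc1n hxn
  have t3 : ‖n₁ * c 1 * x ^ 2‖ ≤ 6 * 16800 * ‖x‖ ^ 2 := by
    rw [norm_mul, norm_mul, norm_pow]
    exact mul_le_mul (mul_le_mul hn1le hc1 (norm_nonneg _) (by norm_num)) le_rfl (by positivity) (by positivity)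
  have t4 : ‖n₁ * x * C₂‖ ≤ 6 * (3 / 5) * (1100 * 2100 * ‖x‖ ^ 2) := by
    rw [norm_mul, norm_mul]
    exact mul_le_mul (mul_le_mul hn1le hx hxn (by norm_num)) hC2 (norm_nonneg _) (by positivity)
  rw [hdecomp]
  calc ‖N₂ * C + (c 1 - n₁) * x - n₁ * c 1 * x ^ 2 - n₁ * x * C₂ + C₂‖
      ≤ ‖N₂ * C‖ + ‖(c 1 - n₁) * x‖ + ‖n₁ * c 1 * x ^ 2‖ + ‖n₁ * x * C₂‖ + ‖C₂‖ := by
        have e1 := norm_add_le (N₂ * C + (c 1 - n₁) * x - n₁ * c 1 * x ^ 2 - n₁ * x * C₂) C₂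
        have e2 := norm_sub_le (N₂ * C + (c 1 - n₁) * x - n₁ * c 1 * x ^ 2) (n₁ * x * C₂)
        have e3 := norm_sub_le (N₂ * C + (c 1 - n₁) * x) (n₁ * c 1 * x ^ 2)
        have e4 := norm_add_le (N₂ * C) ((c 1 - n₁) * x)
        linarith
    _ ≤ 35 * ‖x‖ ^ 2 * (240 * 2100) + 8500 / q * ‖x‖ + 6 * 16800 * ‖x‖ ^ 2 +
          6 * (3 / 5) * (1100 * 2100 * ‖x‖ ^ 2) + 1100 * 2100 * ‖x‖ ^ 2 := by
        linarith [t1, t2, t3, t4, hC2]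
    _ ≤ 8500 * ‖x‖ / q + 30000000 * ‖x‖ ^ 2 := by
        rw [div_mul_eq_mul_div]
        nlinarith [sq_nonneg ‖x‖]

omit [NeZero D] in
/-- The same bound in terms of `σ`: `‖Φ_q(s) − 1‖ ≤ 30008500·q^{−9/5}` for `σ > 9/10`, `q ≥ 700`, `χ(q) = ±1`
(`‖q^{−s}‖/q = q^{−σ−1} ≤ q^{−9/5}`, `‖q^{−s}‖² = q^{−2σ} ≤ q^{−9/5}`).
[cite: Zhang2022LandauSiegel, App. A p.105] -/
theorem norm_x_bounds {q : ℕ} (hq : q.Prime) {s : ℂ} (hs : 9 / 10 < s.re) :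
    ‖(q : ℂ) ^ (-s)‖ / q ≤ (q : ℝ) ^ (-(9 / 5 : ℝ)) ∧ ‖(q : ℂ) ^ (-s)‖ ^ 2 ≤ (q : ℝ) ^ (-(9 / 5 : ℝ)) := by
  have hq1 : (1 : ℝ) ≤ q := by exact_mod_cast hq.one_lt.le
  have hq0 : (0 : ℝ) < q := by linarith
  rw [Complex.norm_natCast_cpow_of_pos hq.pos, Complex.neg_re]
  constructor
  · rw [div_eq_mul_inv, ← Real.rpow_neg_one, ← Real.rpow_add hq0]
    exact Real.rpow_le_rpow_of_exponent_le hq1 (by linarith)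
  · rw [← Real.rpow_natCast, ← Real.rpow_mul hq0.le]
    exact Real.rpow_le_rpow_of_exponent_le hq1 (by push_cast; linarith)

end Generic

/-! ## §5. The primes with `χ(q) = 0`: `Φ_q(s) = (1 − q^{−s})²` exactly -/

section Ramified

variable (c' : ℝ) {D : ℕ} [NeZero D] (χ : DirichletCharacter ℂ D) (j : ℕ)

/-- `‖q^{−s}‖ < 1` for `q ≥ 2`, `Re s > 0`. [folklore] -/
private theorem norm_cpow_neg_lt_one' {q : ℕ} (hq : q.Prime) {s : ℂ} (hs : 0 < s.re) : ‖(q : ℂ) ^ (-s)‖ < 1 := by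
  rw [Complex.norm_natCast_cpow_of_pos hq.pos, Complex.neg_re]
  exact Real.rpow_lt_one_of_one_lt_of_neg (by exact_mod_cast hq.one_lt) (by linarith)

omit [NeZero D] in
/-- At a prime with `χ(q) = 0` the Euler factor `F_q(d,l;s)` does not depend on `(d,l)` (`λ̃₂ = 1`,
the `χ(q)q/(q−1)`-term of the local series vanishes, `c_d = 1`). [cite: Zhang2022LandauSiegel, §16 p.91, App. A p.105] -/
theorem calM2Factor_eq_one_one_of_apply_eq_zero {q : ℕ} (hq : q.Prime) (hv : χ (q : ZMod D) = 0) (d l : ℕ)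
    {s : ℂ} (hs : 0 < s.re) : calM2Factor c' χ q d l s = calM2Factor c' χ q 1 1 s := by
  have hx : ‖(q : ℂ) ^ (-s)‖ < 1 := norm_cpow_neg_lt_one' hq hs
  unfold calM2Factor
  rw [lamTilde2_prime c' χ hq d, lamTilde2_prime c' χ hq 1, xi2LocalSeries_prime c' χ hq d l s hx,
    xi2LocalSeries_prime c' χ hq 1 1 s hx, hv]
  simp [locLam, Nat.coprime_one_right_eq_true]

omit [NeZero D] in
/-- **`ϖ₂ⱼ^loc(q^e) = (q^e)^{β_j}` at a prime with `χ(q) = 0`** (only the divisor pair `(q^e, 1)` survives;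
`λ₂(q) = 1`, `ρ = 1`), provided `F_q(1,1;1−β_j) ≠ 0`. [cite: Zhang2022LandauSiegel, §16 p.93] -/
theorem varpi2loc_prime_pow_of_apply_eq_zero {q : ℕ} (hq : q.Prime) (hv : χ (q : ZMod D) = 0)
    (hF : calM2Factor c' χ q 1 1 (1 - betaJ c' D j) ≠ 0) (e : ℕ) :
    varpi2loc c' χ j (q ^ e) = ((q ^ e : ℕ) : ℂ) ^ betaJ c' D j := by
  rcases Nat.eq_zero_or_pos e with rfl | he
  · simp [varpi2loc_one]
  have hs0 : 0 < (1 - betaJ c' D j).re := by rw [one_sub_betaJ_re]; norm_num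
  rw [varpi2loc_prime_pow c' χ hq he.ne' j, Finset.sum_range_succ, Nat.sub_self, pow_zero, pow_zero, mul_one]
  rw [Finset.sum_eq_zero fun a ha => ?_, zero_add]
  · have hlam : lam2 c' χ (q ^ e) 1 = 1 := by
      rw [lam2_prime_pow c' χ hq e, if_neg he.ne', Typed.Section16ALeaves.lam2_prime c' χ hq, hv]; simp
    have hρ : locRatio c' χ q (q ^ e) 1 (1 - betaJ c' D j) = 1 := by
      unfold locRatio
      rw [calM2Factor_eq_one_one_of_apply_eq_zero c' χ hq hv _ _ hs0, div_self hF]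
    rw [hlam, hρ, one_mul, mul_one]
  · have ha' : a < e := Finset.mem_range.mp ha
    rw [hv, zero_pow (by omega), mul_zero, zero_mul]

omit [NeZero D] in
/-- `((q^e))^{β} = (q^{β})^e`. [folklore] -/
private theorem natCast_pow_cpow' (q e : ℕ) (s : ℂ) : ((q ^ e : ℕ) : ℂ) ^ s = ((q : ℂ) ^ s) ^ e := by
  induction e with
  | zero => simp
  | succ e ih => rw [pow_succ, Nat.cast_mul, Complex.natCast_mul_natCast_cpow, ih, pow_succ]

omit [NeZero D] in
/-- **`Φ_q(s) = (1 − q^{−s})²` at a prime with `χ(q) = 0`** (`Re s > 0`, `F_q(1,1;1−β_j) ≠ 0`):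
`C_q(s) = Σ_e (q^{β_j}q^{−s})^e = (1 − q^{β_j}q^{−s})⁻¹` and `N_q = (1−q^{−s})²(1−q^{β_j}q^{−s})`.
[cite: Zhang2022LandauSiegel, §16 Lemma 16.2 p.94] -/
theorem Phi_eq_of_apply_eq_zero {q : ℕ} (hq : q.Prime) (hv : χ (q : ZMod D) = 0)
    (hF : calM2Factor c' χ q 1 1 (1 - betaJ c' D j) ≠ 0) {s : ℂ} (hs : 0 < s.re) :
    (1 - (q : ℂ) ^ (-s)) ^ 2 * (1 - (q : ℂ) ^ betaJ c' D j * (q : ℂ) ^ (-s)) *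
          (1 - χ (q : ZMod D) * (q : ℂ) ^ (-s)) * (1 - χ (q : ZMod D) * ((q : ℂ) ^ betaJ c' D j * (q : ℂ) ^ (-s))) ^ 2 *
        (∑' e : ℕ, varpi2loc c' χ j (q ^ e) * nuConvChi χ (q ^ e) * ((q : ℂ) ^ (-s)) ^ e) =
      (1 - (q : ℂ) ^ (-s)) ^ 2 := by
  set x : ℂ := (q : ℂ) ^ (-s) with hxdef
  set w : ℂ := (q : ℂ) ^ betaJ c' D j with hwdef
  have hx1 : ‖x‖ < 1 := norm_cpow_neg_lt_one' hq hs
  have hw : ‖w‖ = 1 := by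
    rw [hwdef, Complex.norm_natCast_cpow_of_pos hq.pos, betaJ_re_eq_zero, Real.rpow_zero]
  have hwx : ‖w * x‖ < 1 := by rw [norm_mul, hw, one_mul]; exact hx1
  have hgeom := hasSum_geometric_of_norm_lt_one hwx
  have hC : ∑' e : ℕ, varpi2loc c' χ j (q ^ e) * nuConvChi χ (q ^ e) * x ^ e = (1 - w * x)⁻¹ := by
    rw [← hgeom.tsum_eq]
    refine tsum_congr fun e => ?_
    rw [varpi2loc_prime_pow_of_apply_eq_zero c' χ j hq hv hF e, nuConvChi_prime_pow_of_apply_eq_zero χ hq hv e,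
      natCast_pow_cpow', mul_one, ← mul_pow]
  rw [hC, hv]
  have hne : 1 - w * x ≠ 0 := by
    intro h
    have : ‖w * x‖ = 1 := by rw [show w * x = 1 from by linear_combination -h]; simp
    linarith
  have hinv : (1 - w * x) * (1 - w * x)⁻¹ = 1 := mul_inv_cancel₀ hne
  calc (1 - x) ^ 2 * (1 - w * x) * (1 - 0 * x) * (1 - 0 * (w * x)) ^ 2 * (1 - w * x)⁻¹
      = (1 - x) ^ 2 * ((1 - w * x) * (1 - w * x)⁻¹) := by ring
    _ = (1 - x) ^ 2 := by rw [hinv, mul_one]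

end Ramified

end Literature.NumberTheory.LFunctions.Zhang2022.Lemma162R

end
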